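import Mathlib
import Summits.PneNP.PneNP.Theorems.LatticeMagicTargetSqueezeAssembly
import Literature.Computability.Complexity.ProofComplexityNP
import HarnessLib

/-!
# BIRTH SKELETON of piece A = `HypothesisST` (Krajíček's Hypothesis (ST)) — split of crux `Target` (stmt-PneNP-10709), route LatticeMagic

BC3 for the crux piece `HypothesisST` (prepared child of `Target`, filed as stmt-PneNP-18325; line
`Cruxes/Target/Lines/KrajicekSplit.lean`, stub `stub_hypothesisST`): TWO NAMED STUBS and the kernel-checked composition.

* `stub_injOWF` — apex A of line `SketchIdeator5` (conjecture-grade, Minicrypt): a length-wise injective, length-regular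
  one-way function with a hard-core predicate. Through the LANDED cryptographic leg `st_of_injOWF` (game / Levin / bridge,
  Theorems/LatticeMagicTargetStub*.lean) it gives the EF-free form of (ST): a Cook–Reckhow system for TAUT with an ST-hard DD problem.
  PRICE TAG: ⟹ PneNP (`pneNP_of_injOWF`, landed).
* `stub_efVerifier` — **EF is a Cook–Reckhow proof system** (Cook–Reckhow 1979 §4: extended-Frege proofs are checkable in
  polynomial time; Krajíček 2019 §4.5): some verifier `E` is a proof system for TAUT and weakly simulates EF over the tree's
  `textbookFrege` (`E (encode φ) (encode π) := [π is an EF-proof of φ]`, `IsEFProofOf` decidable in p-time). A THEOREM; formalisation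
  M/L-sized (the wall `textbookEF_hasPolyTimeVerifier` met by worker W3 of lead a1).

Composition: the JOIN of the two systems (§1, the join lemmas of the line file) is a proof system for TAUT, simulates EF through its
`E`-branch and is ST-hard through its `V`-branch (`stHyp_mono`) — `HypothesisST_of`. Sorries ONLY in the two stubs.
-/

set_option linter.dupNamespace false

namespace Summit.PneNP.PneNP.Cruxes.Target.KrajicekSplit.BirthST

open Literature.Computability.Complexity Literature.Computability.Cryptography
open Literature.Computability.MetaComplexity
open _root_.Computability
open Summit.PneNP.PneNP.Theorems Summit.PneNP.PneNP.Theorems.LatticeMagicTarget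

/-! ### 1. The join of two proof systems -/

/-- The join `V ⊔ W` of two verifiers: a proof is accepted if either system accepts it. [folklore] -/
def joinV (V W : List Bool → List Bool → Bool) (x π : List Bool) : Bool :=
  V x π || W x π

/-- The join as a one-bit string function on `⟨x, π⟩`: branch on the accept bit of `V`. [folklore] -/
noncomputable def joinFn (V W : List Bool → List Bool → Bool) : List Bool → List Bool :=
  iteFn (fun z => [V (boolUnpair z).1 (boolUnpair z).2]) (fun _ => [true])
    (fun z => [W (boolUnpair z).1 (boolUnpair z).2])

/-- `joinFn ∈ FP` for polynomial-time verifiers. [folklore] -/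
theorem joinFn_mem_FP {V W : List Bool → List Bool → Bool} (hV : IsPolyTimeVerifier V)
    (hW : IsPolyTimeVerifier W) : joinFn V W ∈ FP := by
  unfold joinFn
  exact iteFn_mem_FP (verifierFn_mem_FP hV) (const_mem_FP _) (verifierFn_mem_FP hW)

/-- Value of `joinFn` on a pair. [folklore] -/
theorem joinFn_boolPair (V W : List Bool → List Bool → Bool) (x π : List Bool) :
    joinFn V W (boolPair x π) = [joinV V W x π] := by
  unfold joinFn joinV
  cases hV : V x π with
  | true => rw [iteFn_apply_true (by simp [boolUnpair_boolPair, hV])]; simp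
  | false => rw [iteFn_apply_false (by simp [boolUnpair_boolPair, hV])]; simp [boolUnpair_boolPair]

/-- **The join of two polynomial-time verifiers is polynomial time.** [folklore] -/
theorem isPolyTimeVerifier_joinV {V W : List Bool → List Bool → Bool} (hV : IsPolyTimeVerifier V)
    (hW : IsPolyTimeVerifier W) : IsPolyTimeVerifier (joinV V W) := by
  refine (joinFn_mem_FP hV hW).of_encode (fun p : List Bool × List Bool => boolPair p.1 p.2)
    (fun _ => rfl) fun p => ?_
  obtain ⟨x, π⟩ := p
  simp only [id, joinFn_boolPair]
  rfl

/-- **The join of two proof systems for `L` is a proof system for `L`.** [folklore] -/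
theorem isProofSystemFor_joinV {L : Language Bool} {V W : List Bool → List Bool → Bool}
    (hV : IsProofSystemFor V L) (hW : IsProofSystemFor W L) : IsProofSystemFor (joinV V W) L := by
  refine ⟨isPolyTimeVerifier_joinV hV.1 hW.1, fun x => ⟨fun hx => ?_, ?_⟩⟩
  · obtain ⟨π, hπ⟩ := (hV.2 x).1 hx
    exact ⟨π, by simp [joinV, hπ]⟩
  · rintro ⟨π, hπ⟩
    simp only [joinV, Bool.or_eq_true] at hπ
    rcases hπ with hπ | hπ
    · exact (hV.2 x).2 ⟨π, hπ⟩
    · exact (hW.2 x).2 ⟨π, hπ⟩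

/-- ST-hardness passes to the join (every `V`-proof is a `V ⊔ W`-proof; `stHyp_mono`). [folklore] -/
theorem stHyp_joinV {V W : List Bool → List Bool → Bool} (h : STHyp V) : STHyp (joinV V W) :=
  stHyp_mono V (joinV V W) (fun x π hx => by simp [joinV, hx]) h

/-- The join with a polynomially bounded proof system for the same language is polynomially bounded.
[folklore] -/
theorem isPolyBounded_joinV {L : Language Bool} {V W : List Bool → List Bool → Bool}
    (hV : IsProofSystemFor V L) (hW : IsProofSystemFor W L) (hWb : IsPolyBounded W) :
    IsPolyBounded (joinV V W) := by
  obtain ⟨p, hp⟩ := hWb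
  refine ⟨p, fun x π hπ => ?_⟩
  have hx : x ∈ L := (isProofSystemFor_joinV hV hW).mem_of_eq_true hπ
  obtain ⟨π₀, hπ₀⟩ := (hW.2 x).1 hx
  obtain ⟨π', hlen, hπ'⟩ := hp x π₀ hπ₀
  exact ⟨π', hlen, by simp [joinV, hπ']⟩

/-- EF-simulation passes to the join through the right branch (every `W`-proof is a `V ⊔ W`-proof). [folklore] -/
theorem simulatesEF_joinV_right {V W : List Bool → List Bool → Bool} (h : SimulatesEF W) :
    SimulatesEF (joinV V W) := by
  obtain ⟨p, hp⟩ := h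
  refine ⟨p, fun π φ hπφ => ?_⟩
  obtain ⟨π', hlen, hπ'⟩ := hp π φ hπφ
  exact ⟨π', hlen, by simp [joinV, hπ']⟩

/-! ### 2. The two stubs and the composition -/

/-- **STUB — apex A of line `SketchIdeator5`** (conjecture-grade; Minicrypt): an injective-on-lengths,
length-regular one-way function with a hard-core predicate exists (classical witness: any one-way
PERMUTATION + Goldreich–Levin, `injOWF_of_oneWayPermutation`, landed; the card's lattice witness: the
GL-extension of the partial-NTT / ideal-lattice syndrome map, injective by `stub_amgm`). PRICE TAG: implies
`OWFExist`, hence `P ≠ NP` and `PneNP` (`pneNP_of_injOWF`, landed). [cite: Goldreich2001, Def. 2.5.1 and Thm. 2.5.2] -/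
theorem stub_injOWF :
    ∃ (g : List Bool → List Bool) (B : List Bool → Bool),
      InjOnLengths g ∧ IsLengthRegular g ∧ IsOneWay g ∧ IsHardCorePredicate B g := by
  sorry

/-- **STUB — EF is a Cook–Reckhow proof system** (THEOREM: Cook–Reckhow 1979 §4, Prop. 4.2 soundness +
p-time checkability of extended-Frege proofs; Krajíček 2019 §4.5): some polynomial-time verifier `E` is a
sound and complete proof system for `TAUT` that weakly simulates EF over `textbookFrege` — e.g.
`E (encode φ) w := [w = encode π for an EF-proof π of φ]`, complete because EF extends the complete
`textbookFrege` (`TextbookFregeCompleteness`), simulating EF with `p = X`. Size M/L (a p-time decision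
procedure for `IsEFProofOf` in the tree's `FP` bricks; cf. `FregeVerifierMachine` for the Frege case).
[cite: CookReckhow1979, §4 Prop. 4.2 and Def. 4.1] -/
theorem stub_efVerifier :
    ∃ E : List Bool → List Bool → Bool, IsProofSystemFor E TAUT ∧ SimulatesEF E := by
  sorry

/-- **The composition: the two stubs give Hypothesis (ST) verbatim** (= route item `HypothesisST`, the
definiens of `StrongST`): join the ST-hard system of the cryptographic leg (`st_of_injOWF stub_injOWF`) with
the EF-verifier. [cite: Krajicek2025Squeeze, §2 Hypothesis (ST) and Lemma 2.2] -/
theorem HypothesisST_of :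
    ∃ V : List Bool → List Bool → Bool, IsProofSystemFor V TAUT ∧ SimulatesEF V ∧ STHyp V := by
  obtain ⟨V, hV, hST⟩ := st_of_injOWF stub_injOWF
  obtain ⟨E, hE, hEF⟩ := stub_efVerifier
  exact ⟨joinV V E, isProofSystemFor_joinV hV hE, simulatesEF_joinV_right hEF, stHyp_joinV hST⟩

/-- The same, as the tree's constant `StrongST`. -/
theorem strongST_of : StrongST :=
  HypothesisST_of

end Summit.PneNP.PneNP.Cruxes.Target.KrajicekSplit.BirthST
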